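import Summits.Ventures.LatticeQCDFlow.Scaling.TouchChainMoments

/-!
HONEST FRAMING: exact (Metropolis-corrected) sampling algorithms for lattice gauge theory; figures
of merit are autocorrelation/cost numbers at stated couplings and volumes; no continuum-physics
claim.

# TouchChainCover — THE SCHEDULE COVERS `T` AT THE COUPON-COLLECTOR TIME, FROM BOTH SIDES: WITH `s_n = Σ_{k∈T}(1−θ_k)ⁿ`
# THE PROBABILITY THAT SOME COORDINATE OF `T` IS STILL UNTOUCHED AT TIME `n` LIES IN `[1 − 1/s_n, s_n]`; WITH `θ_k ≥ θ`
# ON `T` IT IS `≤ |T|·e^{−nθ}`, SO `≤ e^{−c}` AFTER `n ≥ (log|T| + c)/θ` STEPS (lean-2 GEN-24, ours)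

Venture-side (OURS).  Cell `lqcd-flow` (pub-lqcd), unit `pub-lqcd-lean-2-g24`, 2026-08-27.  Chapter L (the coupon-collector
law from a cold start), file 10: the easy (union-bound) direction of the coupon collector for the TOUCH CHAIN of
`Scaling/UntouchedReplicas` / `Scaling/TouchChainMoments` (`R(U,V) = Σ_a c_a·𝟙{V = U ∖ τ a}` from `δ_T`,
`θ_k = Σ_{a ∋ k} c_a`), complementing the Chebyshev direction `(δ_T Rⁿ)(∅) ≤ 1/s_n` proved there.  No independence of
`T` is needed for this direction.

## What is proved

* §1 **`touch_lawAt_nonempty_le_sum`** — `(δ_T Rⁿ){V ≠ ∅} ≤ s_n` (union bound over the coordinates of `T`, the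
  indicator `𝟙{k ∈ V}` having mean `(1−θ_k)ⁿ`); **`touch_lawAt_empty_ge`** — `(δ_T Rⁿ)(∅) ≥ 1 − s_n`;
  **`touch_lawAt_empty_two_sided`** — on an independent `T` with `s_n > 0`: `1 − s_n ≤ (δ_T Rⁿ)(∅) ≤ 1/s_n`.
* §2 `touchSum_le_card_mul_pow` (`θ_k ≥ θ ≥ 0` on `T` ⇒ `s_n ≤ |T|(1−θ)ⁿ`)
  (`(1−θ)ⁿ ≤ e^{−nθ}`), **`touch_lawAt_nonempty_le_exp`** — `(δ_T Rⁿ){V ≠ ∅} ≤ |T|·e^{−nθ}`;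
  **`touch_lawAt_nonempty_le_of_ge_log`** — `n ≥ (log|T| + c)/θ ⇒ (δ_T Rⁿ){V ≠ ∅} ≤ e^{−c}`.

Reading (no numerics implied): the schedule alone (which coordinates are proposed how often) has covered every
coordinate of `T` by the coupon-collector time `(1/θ)·log|T|` up to an additive `c/θ`, with failure probability `e^{−c}`;
together with `Scaling/TouchChainMoments` the cover time of the schedule is pinned at `(1/θ)·log|T|` from both sides.
This is a statement about PROPOSALS only — covering `T` is necessary for mixing (`Scaling/CollectorFloor`), not
sufficient.  NOT CLAIMED: any mixing-time ceiling.  Literature grade (cell rule): KNOWN MECHANISM (Levin–Peres–Wilmer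
Prop. 2.4, the coupon-collector union bound), NEW TYPING for set-valued lazy schedules; nothing cited as a fact; no new
bib keys.
-/

noncomputable section

open Finset Function
open Literature.Probability.MarkovChains

namespace Summit.Ventures.LatticeQCDFlow.Scaling

variable {L ι : Type*} [Fintype L] [DecidableEq L] [Fintype ι] {c : ι → ℝ} {τ : ι → Finset L}
  {R : Finset L → Finset L → ℝ}

/-! ## §1 The union bound and the two-sided cover estimate -/

/-- **`(δ_T Rⁿ){V ≠ ∅} ≤ s_n = Σ_{k∈T}(1−θ_k)ⁿ`** — union bound over the untouched coordinates. [ours] -/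
theorem touch_lawAt_nonempty_le_sum (hc : ∀ a, 0 ≤ c a) (hc1 : ∑ a, c a = 1)
    (hR : ∀ U V, R U V = ∑ a, c a * (if V = U \ τ a then (1 : ℝ) else 0)) (T : Finset L) (n : ℕ) :
    ∑ V ∈ univ.filter (fun V : Finset L => V ≠ ∅), lawAt R (Pi.single T 1) n V
      ≤ ∑ k ∈ T, (1 - ∑ a ∈ univ.filter (fun a => k ∈ τ a), c a) ^ n := by
  set ρ := lawAt R (Pi.single T 1) n with hρ
  have hRst := touch_isRowStochastic hc hc1 hR
  have hρ0 : ∀ V, 0 ≤ ρ V := fun V => lawAt_nonneg hRst (fun U => by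
    by_cases h : U = T
    · subst h; rw [Pi.single_eq_same]; norm_num
    · rw [Pi.single_eq_of_ne h]) n V
  -- a non-empty `V` in the support lies inside `T`, so it contains some `k ∈ T`: `𝟙{V ≠ ∅} ≤ Σ_{k∈T} 𝟙{k ∈ V}`
  have hind : ∀ V : Finset L, ρ V * (if V ≠ ∅ then (1 : ℝ) else 0) ≤ ρ V * ∑ k ∈ T, (if k ∈ V then (1 : ℝ) else 0) := by
    intro V
    by_cases hρV : ρ V = 0
    · rw [hρV, zero_mul, zero_mul]
    · refine mul_le_mul_of_nonneg_left ?_ (hρ0 V)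
      split_ifs with hV
      · obtain ⟨k, hk⟩ := Finset.nonempty_iff_ne_empty.mpr hV
        have hkT : k ∈ T := touch_lawAt_support hR T n hρV hk
        exact le_trans (by rw [if_pos hk])
          (Finset.single_le_sum (f := fun k => if k ∈ V then (1 : ℝ) else 0) (fun k _ => by split_ifs <;> norm_num) hkT)
      · exact sum_nonneg fun k _ => by split_ifs <;> norm_num
  calc ∑ V ∈ univ.filter (fun V : Finset L => V ≠ ∅), ρ V
      = ∑ V, ρ V * (if V ≠ ∅ then (1 : ℝ) else 0) := by
        rw [Finset.sum_filter]; exact sum_congr rfl fun V _ => by split_ifs <;> simp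
    _ ≤ ∑ V, ρ V * ∑ k ∈ T, (if k ∈ V then (1 : ℝ) else 0) := sum_le_sum fun V _ => hind V
    _ = ∑ k ∈ T, (1 - ∑ a ∈ univ.filter (fun a => k ∈ τ a), c a) ^ n := touch_lawAt_mean_count hc1 hR T n

/-- **`(δ_T Rⁿ)(∅) ≥ 1 − s_n`** — by the coupon-collector time the schedule has covered `T`. [ours] -/
theorem touch_lawAt_empty_ge (hc : ∀ a, 0 ≤ c a) (hc1 : ∑ a, c a = 1)
    (hR : ∀ U V, R U V = ∑ a, c a * (if V = U \ τ a then (1 : ℝ) else 0)) (T : Finset L) (n : ℕ) :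
    1 - ∑ k ∈ T, (1 - ∑ a ∈ univ.filter (fun a => k ∈ τ a), c a) ^ n ≤ lawAt R (Pi.single T 1) n ∅ := by
  have hRst := touch_isRowStochastic hc hc1 hR
  have hmass : ∑ V, lawAt R (Pi.single T 1) n V = 1 := by
    rw [sum_lawAt hRst, Finset.sum_pi_single', if_pos (mem_univ _)]
  have hsplit := Finset.sum_filter_add_sum_filter_not univ (fun V : Finset L => V ≠ ∅)
    (fun V => lawAt R (Pi.single T 1) n V)
  have hE : univ.filter (fun V : Finset L => ¬V ≠ ∅) = {∅} := by
    ext V; simp only [Finset.mem_filter, Finset.mem_univ, true_and, not_not, Finset.mem_singleton]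
  rw [hmass, hE, Finset.sum_singleton] at hsplit
  linarith [touch_lawAt_nonempty_le_sum hc hc1 hR T n]

/-- **THE COVER OF `T`, TWO-SIDED:** on a set `T` no move touches twice, with `s_n > 0`:
**`1 − s_n ≤ (δ_T Rⁿ)(∅) ≤ 1/s_n`**. [ours] -/
theorem touch_lawAt_empty_two_sided (hc : ∀ a, 0 ≤ c a) (hc1 : ∑ a, c a = 1)
    (hR : ∀ U V, R U V = ∑ a, c a * (if V = U \ τ a then (1 : ℝ) else 0)) (T : Finset L)
    (hT : ∀ a, ∀ k ∈ T, ∀ l ∈ T, k ≠ l → ¬(k ∈ τ a ∧ l ∈ τ a)) (n : ℕ)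
    (hs : 0 < ∑ k ∈ T, (1 - ∑ a ∈ univ.filter (fun a => k ∈ τ a), c a) ^ n) :
    1 - ∑ k ∈ T, (1 - ∑ a ∈ univ.filter (fun a => k ∈ τ a), c a) ^ n ≤ lawAt R (Pi.single T 1) n ∅ ∧
      lawAt R (Pi.single T 1) n ∅ ≤ 1 / ∑ k ∈ T, (1 - ∑ a ∈ univ.filter (fun a => k ∈ τ a), c a) ^ n :=
  ⟨touch_lawAt_empty_ge hc hc1 hR T n, touch_lawAt_empty_le hc hc1 hR T hT n hs⟩

/-! ## §2 Uniform rates: exponential cover -/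

omit [Fintype L] in
/-- `θ_k ≥ θ` on `T`, `θ_k ≤ 1` ⇒ `s_n ≤ |T|·(1−θ)ⁿ`. [ours] -/
theorem touchSum_le_card_mul_pow (hc : ∀ a, 0 ≤ c a) (hc1 : ∑ a, c a = 1) (T : Finset L) {θ : ℝ}
    (hθ : ∀ k ∈ T, θ ≤ ∑ a ∈ univ.filter (fun a => k ∈ τ a), c a) (n : ℕ) :
    ∑ k ∈ T, (1 - ∑ a ∈ univ.filter (fun a => k ∈ τ a), c a) ^ n ≤ (T.card : ℝ) * (1 - θ) ^ n := by
  calc ∑ k ∈ T, (1 - ∑ a ∈ univ.filter (fun a => k ∈ τ a), c a) ^ n ≤ ∑ _k ∈ T, (1 - θ) ^ n :=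
        sum_le_sum fun k hk => pow_le_pow_left₀ (by linarith [touchRate_le_one (τ := τ) hc hc1 k])
          (by linarith [hθ k hk]) n
    _ = (T.card : ℝ) * (1 - θ) ^ n := by rw [sum_const, nsmul_eq_mul]

/-- **`(δ_T Rⁿ){V ≠ ∅} ≤ |T|·e^{−nθ}`** when every coordinate of `T` is touched with probability `≥ θ` per step
(`θ ≤ 1`). [ours] -/
theorem touch_lawAt_nonempty_le_exp (hc : ∀ a, 0 ≤ c a) (hc1 : ∑ a, c a = 1)
    (hR : ∀ U V, R U V = ∑ a, c a * (if V = U \ τ a then (1 : ℝ) else 0)) (T : Finset L) {θ : ℝ} (hθ1 : θ ≤ 1)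
    (hθ : ∀ k ∈ T, θ ≤ ∑ a ∈ univ.filter (fun a => k ∈ τ a), c a) (n : ℕ) :
    ∑ V ∈ univ.filter (fun V : Finset L => V ≠ ∅), lawAt R (Pi.single T 1) n V
      ≤ (T.card : ℝ) * Real.exp (-(n * θ)) := by
  -- `(1−θ)ⁿ ≤ e^{−nθ}` (`1 − θ ≤ e^{−θ}`)
  have hpow : (1 - θ) ^ n ≤ Real.exp (-(n * θ)) := by
    calc (1 - θ) ^ n ≤ (Real.exp (-θ)) ^ n := by
          apply pow_le_pow_left₀ (by linarith)
          have := Real.add_one_le_exp (-θ)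
          linarith
      _ = Real.exp (-(n * θ)) := by rw [← Real.exp_nat_mul]; ring_nf
  exact (touch_lawAt_nonempty_le_sum hc hc1 hR T n).trans ((touchSum_le_card_mul_pow hc hc1 T hθ n).trans
    (mul_le_mul_of_nonneg_left hpow (Nat.cast_nonneg _)))

/-- **AFTER THE COUPON-COLLECTOR TIME THE SCHEDULE HAS COVERED `T`:** `T` non-empty, `0 < θ ≤ 1`, `θ_k ≥ θ` on `T`,
`n ≥ (log|T| + c)/θ` ⇒ **`(δ_T Rⁿ){V ≠ ∅} ≤ e^{−c}`**. [ours] -/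
theorem touch_lawAt_nonempty_le_of_ge_log (hc : ∀ a, 0 ≤ c a) (hc1 : ∑ a, c a = 1)
    (hR : ∀ U V, R U V = ∑ a, c a * (if V = U \ τ a then (1 : ℝ) else 0)) (T : Finset L) (hTne : T.Nonempty)
    {θ : ℝ} (hθ0 : 0 < θ) (hθ1 : θ ≤ 1) (hθ : ∀ k ∈ T, θ ≤ ∑ a ∈ univ.filter (fun a => k ∈ τ a), c a) {c₀ : ℝ}
    {n : ℕ} (hn : (Real.log T.card + c₀) / θ ≤ n) :
    ∑ V ∈ univ.filter (fun V : Finset L => V ≠ ∅), lawAt R (Pi.single T 1) n V ≤ Real.exp (-c₀) := by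
  have hTpos : (0 : ℝ) < T.card := Nat.cast_pos.mpr hTne.card_pos
  have hnθ : Real.log T.card + c₀ ≤ n * θ := by rwa [div_le_iff₀ hθ0] at hn
  refine (touch_lawAt_nonempty_le_exp hc hc1 hR T hθ1 hθ n).trans ?_
  rw [← Real.exp_log hTpos, ← Real.exp_add]
  exact Real.exp_le_exp.mpr (by linarith)

end Summit.Ventures.LatticeQCDFlow.Scaling

end
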